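import Summits.Ventures.HSemireg.ObstructionLocusBlockNormal

/-!
# Venture HSemireg — (S5) OBSTRUCTION LOCUS away from secant type, XXII: the `ℤⁿ`-GRADING of the multi-block local
# lemma — weight pieces `Hom_R(I_M, R/I_M)_c`, `c ∈ ℤⁿ`, and the monomial `K`-basis `σ_{i,a,b}(x^u)` of the normal
# module (EXT-NOTE §6.0 «everything is `ℤⁿ`-graded», §6.B(a); every block model, every `n`, every commutative `K`)

HONEST FRAMING.  Companion of `ObstructionLocusBlockIdeal/…/BlockNormal.lean` (cell `pub-hsemireg`, track «S4-PUSH»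
(ii), seat s4-prove-2; vocabulary and honest framing as there).  File XIX proved THE MULTI-BLOCK LOCAL LEMMA
`blockNormalModuleEquiv : Hom_R(I_M, R/I_M) ≃ₗ[R] Π_{(i,a,b)} R/(x_b, x_a)` for every block model `M(S_1, …, S_r)`
(general-structure/EXT-NOTE.md §6.B(a) «no poles, no gluing»).  EXT-NOTE §6.0 adds «everything is `ℤⁿ`-graded»,
and §6.B closes with a MACHINE CHECK of (a) «degree by degree»: `dim Hom_R(I, A)_c` computed for 3438 multidegrees
`c` over nine block types (`K_3, K_4, K_5, K_6, K_2⊔K_2, K_3⊔K_2, K_3⊔K_3, K_2⊔K_2⊔K_2, K_4⊔K_3`), 0 mismatches with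
the prediction of (a), column «`Σ_l dim Hom_{−e_l} = 2 · #components`».  This file and its sequel
`ObstructionLocusBlockGradedCount.lean` turn that finite check into a theorem for EVERY `n`, every block model and
EVERY multidegree `c ∈ ℤⁿ`: here the grading itself — the intrinsic weight pieces of the normal module and its
monomial `K`-basis, each basis vector a weight vector; there the weight decomposition and the closed-form count.
Nothing here constructs a variety or a sheaf; nothing here says that HC / HC_CM / HC_AV holds; no Literature fact is
declared or used; no object is certified.  What stays PROSE / BINDER is unchanged (the étale chart
`(X, Z_T)_q ≅ (𝔸ⁿ, M)_0`, sheafification, Prop. K, the Čech line, completion, (R4), §6.B(b)(c)'s `Ext` reading, all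
of (H-NC)): the grading refines the LOCAL-ALGEBRA input of (H-arr) only.

THE GRADING (intrinsic, no torus action needed, any commutative `K`).  `I_M` is a monomial ideal, so `R/I_M` has the
`K`-basis of STANDARD monomials (`x^w ∉ I_M`, `StdExp`) and an `R`-linear `φ : I_M → R/I_M` has WEIGHT `c ∈ ℤⁿ`
(`φ ∈ homWeight K B c`) iff `φ(x^v) ∈ K · [x^{v+c}]` for every monomial `x^v ∈ I_M` (`weightLine`; the line is `0`
when `v + c ∉ ℕⁿ` or `x^{v+c} ∈ I_M`).

PROVED HERE (kernel):
* `dropDiv_monomial` — `T_{a,b}(x^v) = x^{v − e_b}` if `v_a = 0 < v_b`, else `0`; hence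
  **`sigma_monomial_mem_homWeight`: the branch field `σ_{i,a,b}(x^u)` (file XVIII) has weight `u − e_b`** — EXT-NOTE
  §6.B(a)/(b) «generators in multidegrees `(−e_a, −e_b)`» for the two fields `∂_a, ∂_b` of a component `V(x_a, x_b)`.
* `stdCoeff`, `stdCoeff_injective` — the standard coefficients `R/I_M →ₗ[K] (StdExp → K)` are well defined and
  injective (monomial ideal); `eq_zero_of_sum_mem_weightLine` — weight lines of distinct degrees are independent.
* `quotPairBasis` — the monomial `K`-basis `{[x^u] : u_a = u_b = 0}` of `R/(x_b, x_a) = 𝒪(V(x_a, x_b) × 𝔸)`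
  (`linearIndependent_mk_monomial`, `span_mk_monomial_eq_top`, via `MvPolynomial.mem_ideal_span_X_image`).
* **`homBasis` / `homBasis_apply`: `Hom_R(I_M, R/I_M)` has the `K`-basis `σ_{i,a,b}(x^u)`** indexed by
  `HomIndex B = Σ (i,a,b) ∈ Branch B, {u : u_a = u_b = 0}` (file XIX's `blockNormalModuleEquiv` and `Pi.basis` of the
  branch rings), and **`homBasis_mem_homWeight`: every basis vector is a weight vector**, of weight
  `HomIndex.weight (t, u) = u − e_b`.
The sequel proves from this: `Hom_c = span {σ_j : weight j = c}`, `Hom = ⨁_c Hom_c`, and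
`dim_K Hom_c = #{(i,a,b) : c_b = −1, c_a = 0, c ≥ 0 off {a,b}}` with its corollaries (the machine-check column).
References (dictionary only): EXT-NOTE.md §6.0, §6.B(a) and its MACHINE CHECK paragraph; STRUCTURE.md §2 (S5)/(S-B),
hypothesis (H-arr); files XV–XXI of this series.
-/

open scoped BigOperators
open MvPolynomial Finset

namespace Summit.Ventures.HSemireg.ObstructionLocus.BlockModel

variable {K : Type*} [CommRing K] {n : ℕ} {ι : Type*}

/-! ## `T_{a,b}` on monomials -/

/-- **`T_{a,b}(c x^v) = c x^{v − e_b}` if `v_a = 0 < v_b`, and `0` otherwise.** -/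
theorem dropDiv_monomial {a b : Fin n} (hab : a ≠ b) (v : Fin n →₀ ℕ) (c : K) :
    dropDiv a b (monomial v c)
      = if v a = 0 ∧ v b ≠ 0 then monomial (v - Finsupp.single b 1) c else 0 := by
  classical
  split_ifs with hv
  · obtain ⟨hva, hvb⟩ := hv
    have hv' : Finsupp.single b 1 + (v - Finsupp.single b 1) = v :=
      add_tsub_cancel_of_le (Finsupp.single_le_iff.2 (Nat.one_le_iff_ne_zero.2 hvb))
    have h0 : (v - Finsupp.single b 1 : Fin n →₀ ℕ) a = 0 := by
      rw [Finsupp.tsub_apply, hva, zero_tsub]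
    ext s
    rw [coeff_dropDiv, coeff_monomial, coeff_monomial]
    by_cases hs : v - Finsupp.single b 1 = s
    · subst hs
      rw [if_pos h0, hv', if_pos rfl, if_pos rfl]
    · rw [if_neg hs]
      split_ifs with hsa hvs
      · exact absurd (by rw [hvs, add_tsub_cancel_left]) hs
      · rfl
      · rfl
  · ext s
    rw [coeff_dropDiv, coeff_monomial, coeff_zero]
    split_ifs with hsa hvs
    · exfalso
      apply hv
      subst hvs
      refine ⟨?_, ?_⟩
      · rwa [Finsupp.add_apply, Finsupp.single_apply, if_neg hab.symm, zero_add]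
      · rw [Finsupp.add_apply, Finsupp.single_eq_same]; omega
    · rfl
    · rfl

/-- The product of a monic monomial with a monomial. -/
theorem monomial_one_mul_monomial (u w : Fin n →₀ ℕ) (c : K) :
    monomial u (1 : K) * monomial w c = monomial (u + w) c := by
  rw [monomial_mul, one_mul]

/-! ## Standard monomials of `R/I_M` and their coefficient functionals -/

/-- STANDARD EXPONENTS of the block model: `x^w ∉ I_M`, i.e. in some block `w` vanishes at two coordinates
(`¬ BlockMem`) — the exponents whose coefficient functionals descend to `R/I_M`. -/
abbrev StdExp (B : Blocks ι n) : Type _ := {w : Fin n →₀ ℕ // ¬ ∀ i, BlockMem (B.S i) w}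

/-- For `c ≠ 0`: `c x^w ∈ I_M` iff `w` passes `BlockMem` in every block. -/
theorem monomial_mem_arrIdeal_iff (B : Blocks ι n) (w : Fin n →₀ ℕ) {c : K} (hc : c ≠ 0) :
    monomial w c ∈ arrIdeal K B ↔ ∀ i, BlockMem (B.S i) w := by
  classical
  rw [mem_arrIdeal_iff']
  simp only [support_monomial, if_neg hc, Finset.mem_singleton, forall_eq]

/-- The coefficients of an element of `I_M` at standard exponents vanish (monomial ideal). -/
theorem coeff_eq_zero_of_mem (B : Blocks ι n) {p : MvPolynomial (Fin n) K} (hp : p ∈ arrIdeal K B) (w : StdExp B) :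
    coeff w.1 p = 0 := by
  by_contra h
  exact w.2 ((mem_arrIdeal_iff'.1 hp) w.1 (mem_support_iff.2 h))

variable (K) in
/-- **STANDARD COEFFICIENTS** `R/I_M →ₗ[K] (StdExp → K)`, `[p] ↦ (w ↦ coeff_w p)` — well defined because `I_M` is a
monomial ideal. -/
noncomputable def stdCoeff (B : Blocks ι n) : (MvPolynomial (Fin n) K ⧸ arrIdeal K B) →ₗ[K] (StdExp B → K) :=
  Submodule.liftQ ((arrIdeal K B).restrictScalars K) (LinearMap.pi fun w : StdExp B => lcoeff K w.1) (by
    intro p hp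
    rw [LinearMap.mem_ker]
    funext w
    exact coeff_eq_zero_of_mem B hp w)

/-- Its values on representatives. -/
theorem stdCoeff_mk (B : Blocks ι n) (p : MvPolynomial (Fin n) K) (w : StdExp B) :
    stdCoeff K B (Ideal.Quotient.mk (arrIdeal K B) p) w = coeff w.1 p := rfl

/-- **`stdCoeff` is injective**: a polynomial all of whose standard coefficients vanish lies in `I_M`. -/
theorem stdCoeff_injective (B : Blocks ι n) : Function.Injective (stdCoeff K B) := by
  rw [injective_iff_map_eq_zero]
  intro y hy
  obtain ⟨p, rfl⟩ := Ideal.Quotient.mk_surjective y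
  rw [Ideal.Quotient.eq_zero_iff_mem, mem_arrIdeal_iff']
  intro w hw
  by_contra hstd
  have := congr_fun hy ⟨w, hstd⟩
  rw [stdCoeff_mk, Pi.zero_apply] at this
  exact (mem_support_iff.1 hw) this

/-- The standard coefficients of a monomial class are supported at its exponent. -/
theorem stdCoeff_mk_monomial_of_ne (B : Blocks ι n) {w : Fin n →₀ ℕ} {w' : StdExp B} (h : w'.1 ≠ w) (c : K) :
    stdCoeff K B (Ideal.Quotient.mk (arrIdeal K B) (monomial w c)) w' = 0 := by
  classical
  rw [stdCoeff_mk, coeff_monomial, if_neg (Ne.symm h)]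

/-! ## Multidegrees and weight lines -/

/-- The exponents `w` with `w = v + c` in `ℤⁿ` (`v, w ∈ ℕⁿ`, `c ∈ ℤⁿ`): at most one, none if `v + c ∉ ℕⁿ`. -/
def shifts (c : Fin n → ℤ) (v : Fin n →₀ ℕ) : Set (Fin n →₀ ℕ) := {w | ∀ j, (w j : ℤ) = v j + c j}

/-- Membership in `shifts c v`. -/
theorem mem_shifts_iff {c : Fin n → ℤ} {v w : Fin n →₀ ℕ} : w ∈ shifts c v ↔ ∀ j, (w j : ℤ) = v j + c j := Iff.rfl

/-- `v + c` is unique. -/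
theorem eq_of_mem_shifts {c : Fin n → ℤ} {v w w' : Fin n →₀ ℕ} (h : w ∈ shifts c v) (h' : w' ∈ shifts c v) :
    w = w' := by
  ext j
  have := (h j).trans (h' j).symm
  exact_mod_cast this

/-- The degree `c = w − v` is determined by `v` and `w`. -/
theorem deg_eq_of_mem_shifts {c c' : Fin n → ℤ} {v w : Fin n →₀ ℕ} (h : w ∈ shifts c v) (h' : w ∈ shifts c' v) :
    c = c' := by
  funext j
  have h1 := h j
  have h2 := h' j
  omega

variable (K) in
/-- The WEIGHT LINE `K · [x^{v + c}] ⊂ R/I_M` (`⊥` when `v + c ∉ ℕⁿ`, and also when `x^{v+c} ∈ I_M`). -/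
noncomputable def weightLine (B : Blocks ι n) (c : Fin n → ℤ) (v : Fin n →₀ ℕ) :
    Submodule K (MvPolynomial (Fin n) K ⧸ arrIdeal K B) :=
  Submodule.span K ((fun w => Ideal.Quotient.mk (arrIdeal K B) (monomial w 1)) '' shifts c v)

/-- `[x^{v+c}] ∈ K·[x^{v+c}]`. -/
theorem mk_monomial_mem_weightLine (B : Blocks ι n) {c : Fin n → ℤ} {v w : Fin n →₀ ℕ} (hw : w ∈ shifts c v)
    (r : K) : Ideal.Quotient.mk (arrIdeal K B) (monomial w r) ∈ weightLine K B c v := by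
  have : monomial w r = r • monomial w (1 : K) := by rw [smul_monomial, smul_eq_mul, mul_one]
  rw [this, ← Ideal.Quotient.mkₐ_eq_mk K, map_smul]
  refine Submodule.smul_mem _ r (Submodule.subset_span ?_)
  exact ⟨w, hw, rfl⟩

/-- An element of the weight line `K·[x^{v+c}]` has standard coefficients supported at `v + c`. -/
theorem stdCoeff_eq_zero_of_mem_weightLine (B : Blocks ι n) {c : Fin n → ℤ} {v : Fin n →₀ ℕ}
    {y : MvPolynomial (Fin n) K ⧸ arrIdeal K B} (hy : y ∈ weightLine K B c v) {w' : StdExp B}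
    (hw' : w'.1 ∉ shifts c v) : stdCoeff K B y w' = 0 := by
  induction hy using Submodule.span_induction with
  | mem x hx =>
    obtain ⟨w, hw, rfl⟩ := hx
    exact stdCoeff_mk_monomial_of_ne B (fun h => hw' (h ▸ hw)) 1
  | zero => rw [map_zero, Pi.zero_apply]
  | add x y _ _ hx hy => rw [map_add, Pi.add_apply, hx, hy, add_zero]
  | smul a x _ hx => rw [map_smul, Pi.smul_apply, hx, smul_zero]

/-- **Weight lines of distinct degrees are independent**: if `y_d ∈ K·[x^{v+d}]` for `d ∈ D` and
`Σ_{d ∈ D} y_d ∈ K·[x^{v+c}]`, then `y_d = 0` for every `d ∈ D`, `d ≠ c`. -/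
theorem eq_zero_of_sum_mem_weightLine (B : Blocks ι n) {v : Fin n →₀ ℕ} {c : Fin n → ℤ} (D : Finset (Fin n → ℤ))
    (y : (Fin n → ℤ) → MvPolynomial (Fin n) K ⧸ arrIdeal K B) (hy : ∀ d ∈ D, y d ∈ weightLine K B d v)
    (hsum : ∑ d ∈ D, y d ∈ weightLine K B c v) {d : Fin n → ℤ} (hd : d ∈ D) (hdc : d ≠ c) : y d = 0 := by
  apply stdCoeff_injective B
  rw [map_zero]
  funext w
  rw [Pi.zero_apply]
  by_cases hw : w.1 ∈ shifts d v
  · have hsum' := stdCoeff_eq_zero_of_mem_weightLine B hsum (fun h => hdc (deg_eq_of_mem_shifts hw h))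
    rw [map_sum, Finset.sum_apply, Finset.sum_eq_single d] at hsum'
    · exact hsum'
    · intro d' hd' hne
      exact stdCoeff_eq_zero_of_mem_weightLine B (hy d' hd') (fun h => hne (deg_eq_of_mem_shifts h hw))
    · intro h
      exact absurd hd h
  · exact stdCoeff_eq_zero_of_mem_weightLine B (hy d hd) hw

/-! ## Weight pieces of the normal module -/

variable (K) in
/-- **THE WEIGHT-`c` NORMAL FIELDS** `Hom_R(I_M, R/I_M)_c`: the `R`-linear `φ : I_M → R/I_M` with
`φ(x^v) ∈ K·[x^{v+c}]` for every monomial `x^v ∈ I_M` — the degree-`c` piece of the `ℤⁿ`-grading (torus weights)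
of `Hom_R(I_M, R/I_M)`, `I_M` being a monomial ideal. -/
noncomputable def homWeight (B : Blocks ι n) (c : Fin n → ℤ) :
    Submodule K (↥(arrIdeal K B) →ₗ[MvPolynomial (Fin n) K] MvPolynomial (Fin n) K ⧸ arrIdeal K B) where
  carrier := {φ | ∀ (v : Fin n →₀ ℕ) (hv : monomial v (1 : K) ∈ arrIdeal K B),
    φ ⟨monomial v 1, hv⟩ ∈ weightLine K B c v}
  add_mem' {φ ψ} hφ hψ v hv := by
    rw [LinearMap.add_apply]
    exact Submodule.add_mem _ (hφ v hv) (hψ v hv)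
  zero_mem' v hv := by
    rw [LinearMap.zero_apply]
    exact Submodule.zero_mem _
  smul_mem' a {φ} hφ v hv := by
    rw [LinearMap.smul_apply]
    exact Submodule.smul_mem _ a (hφ v hv)

/-- Membership in the weight-`c` piece. -/
theorem mem_homWeight_iff (B : Blocks ι n) (c : Fin n → ℤ)
    (φ : ↥(arrIdeal K B) →ₗ[MvPolynomial (Fin n) K] MvPolynomial (Fin n) K ⧸ arrIdeal K B) :
    φ ∈ homWeight K B c ↔ ∀ (v : Fin n →₀ ℕ) (hv : monomial v (1 : K) ∈ arrIdeal K B),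
      φ ⟨monomial v 1, hv⟩ ∈ weightLine K B c v := Iff.rfl

/-- **The branch field `σ_{i,a,b}(x^u)` has weight `u − e_b`**: on a monomial `x^v ∈ I_M` it is `x^{u + v − e_b}`
if `v_a = 0` (then `v_b ≥ 1`) and `0` otherwise. -/
theorem sigma_monomial_mem_homWeight (B : Blocks ι n) {i : ι} {a b : Fin n} (ha : a ∈ B.S i)
    (hb : b ∈ (B.S i).erase a) (u : Fin n →₀ ℕ) :
    sigma B ha hb (Ideal.Quotient.mk _ (monomial u (1 : K)))
      ∈ homWeight K B (fun j => (u j : ℤ) - (Finsupp.single b 1 : Fin n →₀ ℕ) j) := by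
  classical
  have hab : a ≠ b := fun h => (mem_erase.1 hb).1 h.symm
  intro v hv
  rw [sigma_mk, branchField_apply, dropDiv_monomial hab]
  split_ifs with hva
  · rw [monomial_one_mul_monomial]
    apply mk_monomial_mem_weightLine
    intro j
    have hle : (Finsupp.single b 1 : Fin n →₀ ℕ) j ≤ v j :=
      Finsupp.le_def.1 (Finsupp.single_le_iff.2 (Nat.one_le_iff_ne_zero.2 hva.2)) j
    simp only [Finsupp.add_apply, Finsupp.tsub_apply]
    omega
  · rw [mul_zero, map_zero]
    exact Submodule.zero_mem _

/-! ## The monomial `K`-basis of `R/(x_b, x_a)` -/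

/-- Exponents FREE of `a` and `b`. -/
def freeExp (a b : Fin n) : Set (Fin n →₀ ℕ) := {u | u a = 0 ∧ u b = 0}

/-- Membership in `freeExp a b`. -/
theorem mem_freeExp_iff {a b : Fin n} {u : Fin n →₀ ℕ} : u ∈ freeExp a b ↔ u a = 0 ∧ u b = 0 := Iff.rfl

/-- A monomial involving `x_a` or `x_b` lies in `(x_b, x_a)`. -/
theorem monomial_mem_span_pair {a b : Fin n} {m : Fin n →₀ ℕ} (hm : m ∉ freeExp a b) (c : K) :
    monomial m c ∈ Ideal.span {(X b : MvPolynomial (Fin n) K), X a} := by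
  classical
  have : Ideal.span {(X b : MvPolynomial (Fin n) K), X a} = Ideal.span (X '' {b, a}) := by rw [Set.image_pair]
  rw [this, mem_ideal_span_X_image]
  intro m' hm'
  rw [support_monomial] at hm'
  split_ifs at hm' with hc
  · exact absurd hm' (Finset.notMem_empty _)
  · rw [Finset.mem_singleton] at hm'
    subst hm'
    by_cases hma : m' a = 0
    · exact ⟨b, Set.mem_insert _ _, fun h => hm ⟨hma, h⟩⟩
    · exact ⟨a, Set.mem_insert_of_mem _ (Set.mem_singleton _), hma⟩

/-- A polynomial supported on free exponents and lying in `(x_b, x_a)` is zero. -/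
theorem eq_zero_of_free_of_mem_span {a b : Fin n} {p : MvPolynomial (Fin n) K}
    (hp : p ∈ restrictSupport K (freeExp a b)) (hp' : p ∈ Ideal.span {(X b : MvPolynomial (Fin n) K), X a}) :
    p = 0 := by
  have h2 : p ∈ Ideal.span (X '' {b, a} : Set (MvPolynomial (Fin n) K)) := by rwa [Set.image_pair]
  rw [mem_ideal_span_X_image] at h2
  by_contra hne
  obtain ⟨m, hm⟩ := Finset.nonempty_iff_ne_empty.2 fun h => hne (support_eq_empty.1 h)
  obtain ⟨hma, hmb⟩ := mem_freeExp_iff.1 ((mem_restrictSupport_iff K).1 hp (Finset.mem_coe.2 hm))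
  obtain ⟨j, hj, hmj⟩ := h2 m hm
  rcases hj with rfl | hj
  · exact hmj hmb
  · rw [Set.mem_singleton_iff] at hj
    subst hj
    exact hmj hma

/-- **The classes of the free monomials are `K`-linearly independent in `R/(x_b, x_a)`.** -/
theorem linearIndependent_mk_monomial (a b : Fin n) :
    LinearIndependent K fun u : freeExp a b =>
      Ideal.Quotient.mk (Ideal.span {(X b : MvPolynomial (Fin n) K), X a}) (monomial u.1 (1 : K)) := by
  have hv : LinearIndependent K fun u : freeExp a b => (monomial u.1 (1 : K) : MvPolynomial (Fin n) K) :=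
    (basisMonomials (Fin n) K).linearIndependent.comp _ Subtype.val_injective
  have key := hv.map (f := (Ideal.Quotient.mkₐ K (Ideal.span {(X b : MvPolynomial (Fin n) K), X a})).toLinearMap)
    (by
      rw [Submodule.disjoint_def]
      intro x hx hx0
      rw [LinearMap.mem_ker, AlgHom.toLinearMap_apply, Ideal.Quotient.mkₐ_eq_mk,
        Ideal.Quotient.eq_zero_iff_mem] at hx0
      have hx' : x ∈ restrictSupport K (freeExp a b) := by
        refine (Submodule.span_le.2 ?_) hx
        rintro _ ⟨u, rfl⟩
        exact (monomial_mem_restrictSupport K).2 (Or.inl u.2)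
      exact eq_zero_of_free_of_mem_span hx' hx0)
  exact key

/-- **They span `R/(x_b, x_a)`** (every other monomial dies). -/
theorem span_mk_monomial_eq_top (a b : Fin n) :
    Submodule.span K (Set.range fun u : freeExp a b =>
      Ideal.Quotient.mk (Ideal.span {(X b : MvPolynomial (Fin n) K), X a}) (monomial u.1 (1 : K))) = ⊤ := by
  rw [eq_top_iff]
  rintro y -
  obtain ⟨q, rfl⟩ := Ideal.Quotient.mk_surjective y
  rw [q.as_sum, map_sum]
  refine Submodule.sum_mem _ fun m _ => ?_
  by_cases hfree : m ∈ freeExp a b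
  · have : monomial m (coeff m q) = coeff m q • (monomial m (1 : K) : MvPolynomial (Fin n) K) := by
      rw [smul_monomial, smul_eq_mul, mul_one]
    rw [this, ← Ideal.Quotient.mkₐ_eq_mk K, map_smul]
    exact Submodule.smul_mem _ _ (Submodule.subset_span ⟨⟨m, hfree⟩, rfl⟩)
  · rw [Ideal.Quotient.eq_zero_iff_mem.2 (monomial_mem_span_pair hfree _)]
    exact Submodule.zero_mem _

variable (K) in
/-- **The monomial `K`-basis of `R/(x_b, x_a) = 𝒪(V(x_a, x_b) × 𝔸)`**: the classes of the monomials free of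
`x_a, x_b`. -/
noncomputable def quotPairBasis (a b : Fin n) :
    Module.Basis (freeExp a b) K (MvPolynomial (Fin n) K ⧸ Ideal.span {(X b : MvPolynomial (Fin n) K), X a}) :=
  Module.Basis.mk (linearIndependent_mk_monomial a b) (span_mk_monomial_eq_top a b).ge

/-- Its vectors. -/
theorem quotPairBasis_apply (a b : Fin n) (u : freeExp a b) :
    quotPairBasis K a b u = Ideal.Quotient.mk _ (monomial u.1 1) := by
  rw [quotPairBasis, Module.Basis.mk_apply]

/-! ## The monomial `K`-basis of the normal module -/

variable [Fintype ι] [DecidableEq ι]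

/-- Index of the monomial basis of `Hom_R(I_M, R/I_M)`: a branch datum `t = (i, a, b)` and an exponent `u` free of
`a, b` — the normal field `σ_{i,a,b}(x^u) = «x^u ∂_b on V(x_a, x_b) × 𝔸»`. -/
abbrev HomIndex (B : Blocks ι n) : Type _ := Σ t : Branch B, freeExp t.1.2.1 t.1.2.2

/-- **THE MONOMIAL `K`-BASIS OF THE NORMAL MODULE**: `Hom_R(I_M, R/I_M) = ⊕_{(t,u)} K · σ_t(x^u)` (file XIX's
`blockNormalModuleEquiv` composed with the monomial bases of the branch rings). -/
noncomputable def homBasis (B : Blocks ι n) :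
    Module.Basis (HomIndex B) K
      (↥(arrIdeal K B) →ₗ[MvPolynomial (Fin n) K] MvPolynomial (Fin n) K ⧸ arrIdeal K B) :=
  (Pi.basis fun t : Branch B => quotPairBasis K t.1.2.1 t.1.2.2).map
    ((blockNormalModuleEquiv K B).symm.restrictScalars K)

/-- Its vectors are the monomial branch fields `σ_{i,a,b}(x^u)`. -/
theorem homBasis_apply (B : Blocks ι n) (j : HomIndex B) :
    homBasis B j = sigma B j.1.2.1 j.1.2.2 (Ideal.Quotient.mk _ (monomial j.2.1 (1 : K))) := by
  unfold homBasis
  rw [Module.Basis.map_apply, Pi.basis_apply, LinearEquiv.restrictScalars_apply, quotPairBasis_apply,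
    blockNormalModuleEquiv_symm_single]

/-- The WEIGHT of the basis vector `σ_{i,a,b}(x^u)`: `u − e_b`. -/
noncomputable def HomIndex.weight {B : Blocks ι n} (j : HomIndex B) : Fin n → ℤ :=
  fun l => (j.2.1 l : ℤ) - (Finsupp.single j.1.1.2.2 1 : Fin n →₀ ℕ) l

/-- **Every basis vector is a weight vector**: `σ_{i,a,b}(x^u) ∈ Hom_{u − e_b}`. -/
theorem homBasis_mem_homWeight (B : Blocks ι n) (j : HomIndex B) : homBasis B j ∈ homWeight K B j.weight := by
  rw [homBasis_apply]
  exact sigma_monomial_mem_homWeight B j.1.2.1 j.1.2.2 j.2.1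

end Summit.Ventures.HSemireg.ObstructionLocus.BlockModel
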